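import Summits.QuantumFields.YangMills.Theorems.FemtoTransferGapPhysL2Infinite
import Summits.QuantumFields.YangMills.Theorems.LuscherReductionTwistedTraceScalingTangentChart
import Summits.QuantumFields.YangMills.Theorems.LuscherReductionTwistedTraceScalingCurvatureAction
import Summits.QuantumFields.YangMills.Theorems.LuscherReductionRunningReductionLatticeLinkKernel
import Literature.MathematicalPhysics.QuantumFieldTheory.FlatLatticeGaugeFields
import Literature.MathematicalPhysics.QuantumFieldTheory.Balaban1983to89.T4HaarSU2Translate
import HarnessLib

/-!
# Negative lemma R8 for crux `TwistedTraceScaling` (stmt-QuantumFields-20203): the fixed-`L` "`√σ` FLAT-PROXIMITY" brick is FALSE —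
# the distance to the flat connections is controlled by `S^{1/4}`, not `√S` (Lüscher's quartic modes)

Standing disprover `ym-cdisprove-20203-1` (gen 8).  Lane B's lower-bound blueprint (`pub/ym-fleet/ym-20203-coarse-s1/LOWER-BLUEPRINT.md` §6, brick c5)
and lane A's sub-structure C3c (`COARSE-DESIGN.md` §12; directors' REQUESTS 2026-08-27T19:18Z) both plan to use, AT FIXED LATTICE SIZE `L`,
  (c5/C3c)  `S(U) ≤ σ` small ⇒ `U` is gauge-equivalent to a configuration all of whose links are within `C(L)·√σ` of a FLAT one.
★ `flatProximity_sqrt_false` / `flatProximity_sqrt_false'`: **false for every `L ≥ 1`** — no `C`, `σ₀ > 0` with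
`∀ U, S(U) ≤ σ₀ → ∃ g V, V flat ∧ ∀ e, ‖(g·U)_e − V_e‖_F ≤ C √S(U)`.

WITNESS = the constant NON-COMMUTING connections (the tree's `PhysL2.twoLinkCfg a_φ b_φ`: direction-0 links a rotation by `φ` about the quaternion axis
`i`, direction-1 links by `φ` about `j`, direction-2 links `1`): every `(0,1)` plaquette is `a b a⁻¹ b⁻¹` with `1 − u₀ = 2 sin⁴φ`, the others are trivial,
so `S ≤ 4·#Plaquette·sin⁴φ` is QUARTIC.  Against it: a flat `V` has COMMUTING full-period line holonomies at a common base point (the sliding lemma of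
`Literature/…/FlatLatticeGaugeFields` run once around the torus, `lineHolonomy_comm_of_flat`); the witness has line holonomies `a_φ^L = a_{Lφ}`,
`b_φ^L = b_{Lφ}` (de Moivre); an `L`-link line holonomy is `L`-Lipschitz in the links (`frobNorm_lineHolonomy_sub_le`); and — the load-bearing elementary
fact — two rotations by `ψ` about ORTHOGONAL axes are at Frobenius distance `δ ≥ sin ψ/√2` from every COMMUTING pair (`sq_le_of_commute_near_axes`:
commuting unit quaternions have parallel vector parts), LINEAR in `ψ`.  So `C√S ≳ sin(Lφ)/L ~ φ` against `√S ~ φ²`: contradiction as `φ → 0⁺`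
(Jordan's inequality; the gauge `g` is moved onto `V`, `frobNorm_gaugeTransform_sub_swap`).  NB the COMMUTATOR `‖[a^L,b^L]‖_F = 2√2 sin²(Lφ)` is quadratic
and refutes nothing — distance to the commuting variety, not the commutator, is the right currency.
MORAL / REPAIR (not proved here): the fixed-`L` compactness statement that survives is `dist(U, Flat) ≤ C(L)·S^{1/4}` (sharp on this witness), or
`√σ`-proximity to the orbit of the CONSTANT (not necessarily commuting) configurations — blueprint §5's «near-constant» is right, §6's «flat» is not:
the non-commuting constant directions are the quartic valley of Lüscher's effective Hamiltonian, where the `β^{−1/3}` physics lives.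
## WHAT THIS IS NOT
Fixed-lattice algebra on the Negative/ lane (`--supports stmt-QuantumFields-20203`): refutes a PLANNED AUXILIARY BRICK, not the crux, not a registered
stub; nothing about the continuum or the Clay gap.  HONEST FRAMING: femto rung R2b1, stub support of a child of a CONDITIONAL reduction route.
Sorry-free, no new definition, axioms ⊆ {propext, Classical.choice, Quot.sound}.
-/

set_option autoImplicit false

noncomputable section

open scoped Matrix Quaternion BigOperators
open Literature.MathematicalPhysics.QuantumFieldTheory hiding SU2
open Literature.MathematicalPhysics.QuantumLattice
open Summit.QuantumFields.YangMills.Theorems.FemtoTransferGap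
open Summit.QuantumFields.YangMills.Theorems.FemtoTransferGap.PhysL2 (twoLinkCfg plaquetteHolonomy_twoLinkCfg scalarPart_comm_eq)
open Summit.QuantumFields.YangMills.Theorems.FemtoTransferGap.TwoLattice.Chart (frobNorm_sub_sq_eq)
open Summit.QuantumFields.YangMills.Theorems.FemtoTransferGap.TwoLattice.Cov (hol wilsonAction_eq_sum_scalarPart)

namespace Summit.QuantumFields.YangMills.Theorems.TwistedTraceScaling.Negative.R8

/-! ## §1 Flat configurations have commuting full-period line holonomies (any group, any dimension) -/

section Flat

variable {d L : ℕ} {G : Type*} [Group G]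

/-- `(y + m e_μ) + e_μ = y + (m+1) e_μ`. [folklore] -/
theorem shift_add_single_natCast (y : Site d L) (μ : Fin d) (m : ℕ) :
    (y + Pi.single μ (m : ZMod L)).shift μ = y + Pi.single μ ((m + 1 : ℕ) : ZMod L) := by
  rw [Site.shift, add_assoc, ← Pi.single_add, Nat.cast_succ]

/-- Sliding a whole `μ`-segment across a full `ν`-period: for flat `U`,
`P_μ(m; y) · P_ν(L; y + m e_μ) = P_ν(L; y) · P_μ(m; y)`. [folklore] -/
theorem lineHolonomy_mul_period_of_flat {U : GaugeConfig d L G} (hU : ∀ x i j, plaquetteHolonomy U x i j = 1) (μ ν : Fin d) :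
    ∀ (m : ℕ) (y : Site d L), lineHolonomy U μ m y * lineHolonomy U ν L (y + Pi.single μ (m : ZMod L)) =
      lineHolonomy U ν L y * lineHolonomy U μ m y
  | 0, y => by simp [lineHolonomy]
  | m + 1, y => by
    have hslide := mul_lineHolonomy_shift_eq_of_flat hU μ ν L (y + Pi.single μ (m : ZMod L))
    rw [ZMod.natCast_self, Pi.single_zero, add_zero, shift_add_single_natCast] at hslide
    rw [WilsonLoopRP.lineHolonomy_succ_right, mul_assoc, hslide, ← mul_assoc, lineHolonomy_mul_period_of_flat hU μ ν m y, mul_assoc]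

/-- **Flat ⇒ the full-period line holonomies at a common base point commute** (`P_μ(L; y) P_ν(L; y) = P_ν(L; y) P_μ(L; y)`; the lattice form of
"flat connections on the torus = commuting holonomies", cf. the tree's `flat_iff_exists_gaugeTransform_seamConfig`). [cite: Luscher1983, §2] -/
theorem lineHolonomy_comm_of_flat {U : GaugeConfig d L G} (hU : ∀ x i j, plaquetteHolonomy U x i j = 1) (μ ν : Fin d) (y : Site d L) :
    lineHolonomy U μ L y * lineHolonomy U ν L y = lineHolonomy U ν L y * lineHolonomy U μ L y := by
  have h := lineHolonomy_mul_period_of_flat hU μ ν L y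
  rwa [ZMod.natCast_self, Pi.single_zero, add_zero] at h

end Flat

/-! ## §2 Line holonomies are `n`-Lipschitz in the links (Frobenius distance, `SU(2)`) -/

section Lipschitz

variable {d L : ℕ}

/-- One telescoping step: `‖a p − b q‖_F ≤ ‖a − b‖_F + ‖p − q‖_F` for unitary `b`, `p` (`a p − b q = (a − b) p + b (p − q)`). [folklore] -/
theorem frobNorm_mul_sub_mul_le {a b p q : Matrix (Fin 2) (Fin 2) ℂ} (hb : b ∈ Matrix.unitaryGroup (Fin 2) ℂ)
    (hp : p ∈ Matrix.unitaryGroup (Fin 2) ℂ) : frobNorm (a * p - b * q) ≤ frobNorm (a - b) + frobNorm (p - q) :=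
  calc frobNorm (a * p - b * q) = frobNorm ((a - b) * p + b * (p - q)) := by congr 1; rw [sub_mul, mul_sub]; abel
    _ ≤ frobNorm ((a - b) * p) + frobNorm (b * (p - q)) := frobNorm_add_le _ _
    _ = frobNorm (a - b) + frobNorm (p - q) := by rw [frobNorm_mul_unitary _ hp, frobNorm_unitary_mul hb]

/-- `‖P_k(n; y)(U) − P_k(n; y)(V)‖_F ≤ n · max_e ‖U_e − V_e‖_F` (telescoping). [folklore] -/
theorem frobNorm_lineHolonomy_sub_le {U V : GaugeConfig d L SU2} {r : ℝ}
    (h : ∀ e, frobNorm ((U e : Matrix (Fin 2) (Fin 2) ℂ) - (V e : Matrix (Fin 2) (Fin 2) ℂ)) ≤ r) (k : Fin d) :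
    ∀ (n : ℕ) (y : Site d L), frobNorm (((lineHolonomy U k n y : SU2) : Matrix (Fin 2) (Fin 2) ℂ) -
      ((lineHolonomy V k n y : SU2) : Matrix (Fin 2) (Fin 2) ℂ)) ≤ n * r
  | 0, y => by
    simp only [lineHolonomy, OneMemClass.coe_one, sub_self, frobNorm_zero, Nat.cast_zero, zero_mul, le_refl]
  | n + 1, y => by
    have ih := frobNorm_lineHolonomy_sub_le h k n (y.shift k)
    have he := h (y, k)
    rw [lineHolonomy, lineHolonomy, Submonoid.coe_mul, Submonoid.coe_mul]
    refine (frobNorm_mul_sub_mul_le (su2_mem_unitaryGroup _) (su2_mem_unitaryGroup _)).trans ?_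
    push_cast
    linarith

end Lipschitz

/-! ## §3 Quaternion kit: unit quaternions as links, de Moivre on two orthogonal axes, commuting pairs -/

section Quat

/-- `su2Quat` is multiplicative (the tree's `T4HaarSU2Translate.su2Quat_mul`). [folklore] -/
private theorem quat_mul (U W : SU2) : su2Quat (U * W) = su2Quat U * su2Quat W := Balaban1983to89.T4HaarSU2Translate.su2Quat_mul U W

/-- `su2Quat 1 = 1` (the tree's `T4HaarSU2Translate.su2Quat_one`). [folklore] -/
private theorem quat_one : su2Quat (1 : SU2) = 1 := Balaban1983to89.T4HaarSU2Translate.su2Quat_one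

/-- Every unit quaternion is the quaternion of an element of `SU(2)` (`quatToSU2`). [folklore] -/
theorem exists_su2Quat_eq (q : ℍ) (hq : Quaternion.normSq q = 1) : ∃ a : SU2, su2Quat a = q := by
  have hn2 : ‖q‖ ^ 2 = 1 := by rw [sq, ← Quaternion.normSq_eq_norm_mul_self, hq]
  have hn : ‖q‖ = 1 := (pow_eq_one_iff_of_nonneg (norm_nonneg q) two_ne_zero).1 hn2
  have hq0 : q ≠ 0 := fun h => zero_ne_one (by rw [h, norm_zero] at hn; exact hn)
  exact ⟨quatToSU2 q, by rw [Balaban1983to89.T4HaarSU2Translate.su2Quat_quatToSU2 hq0, hn, inv_one, one_smul]⟩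

/-- The rotation quaternions about the axis `i` are unit. [folklore] -/
theorem normSq_axisI (φ : ℝ) : Quaternion.normSq (⟨Real.cos φ, Real.sin φ, 0, 0⟩ : ℍ) = 1 := by
  rw [Quaternion.normSq_def']; simp

/-- The rotation quaternions about the axis `j` are unit. [folklore] -/
theorem normSq_axisJ (φ : ℝ) : Quaternion.normSq (⟨Real.cos φ, 0, Real.sin φ, 0⟩ : ℍ) = 1 := by
  rw [Quaternion.normSq_def']; simp

/-- De Moivre about the axis `i`: `a_φ^n = a_{nφ}`. [folklore] -/
theorem su2Quat_pow_axisI {a : SU2} {φ : ℝ} (ha : su2Quat a = ⟨Real.cos φ, Real.sin φ, 0, 0⟩) :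
    ∀ n : ℕ, su2Quat (a ^ n) = ⟨Real.cos (n * φ), Real.sin (n * φ), 0, 0⟩
  | 0 => by rw [pow_zero, quat_one]; ext <;> simp
  | n + 1 => by
    rw [pow_succ, quat_mul, su2Quat_pow_axisI ha n, ha]
    ext <;> (simp [Nat.cast_succ, add_mul, one_mul, Real.cos_add, Real.sin_add]; try ring)

/-- De Moivre about the axis `j`: `b_φ^n = b_{nφ}`. [folklore] -/
theorem su2Quat_pow_axisJ {b : SU2} {φ : ℝ} (hb : su2Quat b = ⟨Real.cos φ, 0, Real.sin φ, 0⟩) :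
    ∀ n : ℕ, su2Quat (b ^ n) = ⟨Real.cos (n * φ), 0, Real.sin (n * φ), 0⟩
  | 0 => by rw [pow_zero, quat_one]; ext <;> simp
  | n + 1 => by
    rw [pow_succ, quat_mul, su2Quat_pow_axisJ hb n, hb]
    ext <;> (simp [Nat.cast_succ, add_mul, one_mul, Real.cos_add, Real.sin_add]; try ring)

/-- Reading the matrix entries (`= scalarPart`, `vecPart 0 1 2`) off an explicit quaternion. [folklore] -/
theorem entries_of_su2Quat_eq {X : SU2} {r i j k : ℝ} (h : su2Quat X = ⟨r, i, j, k⟩) :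
    ((X : Matrix (Fin 2) (Fin 2) ℂ) 0 0).re = r ∧ ((X : Matrix (Fin 2) (Fin 2) ℂ) 0 0).im = i ∧
      ((X : Matrix (Fin 2) (Fin 2) ℂ) 0 1).re = j ∧ ((X : Matrix (Fin 2) (Fin 2) ℂ) 0 1).im = k := by
  have h0 := congrArg QuaternionAlgebra.re h; have h1 := congrArg QuaternionAlgebra.imI h
  have h2 := congrArg QuaternionAlgebra.imJ h; have h3 := congrArg QuaternionAlgebra.imK h
  simp only [su2Quat] at h0 h1 h2 h3
  exact ⟨h0, h1, h2, h3⟩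

/-- **Commuting elements of `SU(2)` have parallel vector parts** (third component of `u_X × u_Y = 0`):
`Im(X₀₀)·Re(Y₀₁) = Re(X₀₁)·Im(Y₀₀)`. [folklore] -/
theorem im_mul_re_eq_of_commute {X Y : SU2} (h : X * Y = Y * X) :
    ((X : Matrix (Fin 2) (Fin 2) ℂ) 0 0).im * ((Y : Matrix (Fin 2) (Fin 2) ℂ) 0 1).re =
      ((X : Matrix (Fin 2) (Fin 2) ℂ) 0 1).re * ((Y : Matrix (Fin 2) (Fin 2) ℂ) 0 0).im := by
  have hq : su2Quat X * su2Quat Y = su2Quat Y * su2Quat X := by rw [← quat_mul, h, quat_mul]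
  have hK := congrArg QuaternionAlgebra.imK hq
  simp only [Quaternion.imK_mul, su2Quat] at hK
  linarith

/-- The real-arithmetic core: four coordinates within `δ/√2` of `(s, 0)` / `(0, s)` (`s > 0`) that satisfy the parallelism relation
`p q = u w` force `s² ≤ 2δ²` (else `p, q > s/2` and `|u|, |w| < s/2`). [folklore] -/
theorem sq_le_two_mul_sq_of_parallel {s δ p q u w : ℝ} (hs : 0 < s) (h1 : (s - p) ^ 2 ≤ δ ^ 2 / 2) (h2 : u ^ 2 ≤ δ ^ 2 / 2)
    (h3 : w ^ 2 ≤ δ ^ 2 / 2) (h4 : (s - q) ^ 2 ≤ δ ^ 2 / 2) (hc : p * q = u * w) : s ^ 2 ≤ 2 * δ ^ 2 := by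
  by_contra hnot
  have hlt : 2 * δ ^ 2 < s ^ 2 := lt_of_not_ge hnot
  have hs2 : 0 ≤ s / 2 := by linarith
  have hp : s / 2 < p := by
    by_contra hle
    nlinarith [mul_self_le_mul_self hs2 (show s / 2 ≤ s - p by linarith [le_of_not_gt hle])]
  have hq : s / 2 < q := by
    by_contra hle
    nlinarith [mul_self_le_mul_self hs2 (show s / 2 ≤ s - q by linarith [le_of_not_gt hle])]
  have hu : |u| < s / 2 := abs_lt.2 (abs_lt_of_sq_lt_sq' (show u ^ 2 < (s / 2) ^ 2 by nlinarith) hs2)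
  have hw : |w| < s / 2 := abs_lt.2 (abs_lt_of_sq_lt_sq' (show w ^ 2 < (s / 2) ^ 2 by nlinarith) hs2)
  have hpq : s / 2 * (s / 2) < p * q := mul_lt_mul'' hp hq hs2 hs2
  have huw : u * w < s / 2 * (s / 2) :=
    calc u * w ≤ |u * w| := le_abs_self _
      _ = |u| * |w| := abs_mul u w
      _ < s / 2 * (s / 2) := mul_lt_mul'' hu hw (abs_nonneg _) (abs_nonneg _)
  rw [hc] at hpq
  exact lt_irrefl _ (hpq.trans huw)

/-- **The distance from a pair of equal-angle rotations about ORTHOGONAL axes to the commuting pairs is LINEAR in the angle**: if `A`, `B` have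
quaternions `(c, s, 0, 0)`, `(c, 0, s, 0)` with `s > 0` and `X`, `Y` COMMUTE with `‖A − X‖_F ≤ δ`, `‖B − Y‖_F ≤ δ`, then `s² ≤ 2δ²`. [folklore] -/
theorem sq_le_of_commute_near_axes {X Y A B : SU2} (hXY : X * Y = Y * X) {c s δ : ℝ} (hs : 0 < s)
    (hA : su2Quat A = ⟨c, s, 0, 0⟩) (hB : su2Quat B = ⟨c, 0, s, 0⟩)
    (hX : frobNorm ((A : Matrix (Fin 2) (Fin 2) ℂ) - (X : Matrix (Fin 2) (Fin 2) ℂ)) ≤ δ)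
    (hY : frobNorm ((B : Matrix (Fin 2) (Fin 2) ℂ) - (Y : Matrix (Fin 2) (Fin 2) ℂ)) ≤ δ) : s ^ 2 ≤ 2 * δ ^ 2 := by
  obtain ⟨hAr, hAi, hAj, hAk⟩ := entries_of_su2Quat_eq hA
  obtain ⟨hBr, hBi, hBj, hBk⟩ := entries_of_su2Quat_eq hB
  have hXsq : 2 * ((scalarPart A - scalarPart X) ^ 2 + ∑ t, (vecPart A t - vecPart X t) ^ 2) ≤ δ ^ 2 := by
    rw [← frobNorm_sub_sq_eq]; exact pow_le_pow_left₀ (frobNorm_nonneg _) hX 2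
  have hYsq : 2 * ((scalarPart B - scalarPart Y) ^ 2 + ∑ t, (vecPart B t - vecPart Y t) ^ 2) ≤ δ ^ 2 := by
    rw [← frobNorm_sub_sq_eq]; exact pow_le_pow_left₀ (frobNorm_nonneg _) hY 2
  simp only [Fin.sum_univ_three, scalarPart_eq, vecPart_zero, vecPart_one, vecPart_two, hAr, hAi, hAj, hAk, hBr, hBi, hBj, hBk] at hXsq hYsq
  refine sq_le_two_mul_sq_of_parallel (p := ((X : Matrix (Fin 2) (Fin 2) ℂ) 0 0).im) (q := ((Y : Matrix (Fin 2) (Fin 2) ℂ) 0 1).re)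
    (u := ((X : Matrix (Fin 2) (Fin 2) ℂ) 0 1).re) (w := ((Y : Matrix (Fin 2) (Fin 2) ℂ) 0 0).im) hs ?_ ?_ ?_ ?_ (im_mul_re_eq_of_commute hXY)
  · linarith [sq_nonneg (c - ((X : Matrix (Fin 2) (Fin 2) ℂ) 0 0).re), sq_nonneg (0 - ((X : Matrix (Fin 2) (Fin 2) ℂ) 0 1).re),
      sq_nonneg (0 - ((X : Matrix (Fin 2) (Fin 2) ℂ) 0 1).im)]
  · linarith [sq_nonneg (c - ((X : Matrix (Fin 2) (Fin 2) ℂ) 0 0).re), sq_nonneg (s - ((X : Matrix (Fin 2) (Fin 2) ℂ) 0 0).im),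
      sq_nonneg (0 - ((X : Matrix (Fin 2) (Fin 2) ℂ) 0 1).im)]
  · linarith [sq_nonneg (c - ((Y : Matrix (Fin 2) (Fin 2) ℂ) 0 0).re), sq_nonneg (s - ((Y : Matrix (Fin 2) (Fin 2) ℂ) 0 1).re),
      sq_nonneg (0 - ((Y : Matrix (Fin 2) (Fin 2) ℂ) 0 1).im)]
  · linarith [sq_nonneg (c - ((Y : Matrix (Fin 2) (Fin 2) ℂ) 0 0).re), sq_nonneg (0 - ((Y : Matrix (Fin 2) (Fin 2) ℂ) 0 0).im),
      sq_nonneg (0 - ((Y : Matrix (Fin 2) (Fin 2) ℂ) 0 1).im)]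

end Quat

/-! ## §4 The witness: the two-link constant configuration `twoLinkCfg a_φ b_φ` — action quartic, line holonomies `a_φ^L`, `b_φ^L` -/

section Witness
variable {L : ℕ}

/-- Direction-0 line holonomies of the two-link configuration: `a^n`. [folklore] -/
theorem lineHolonomy_twoLinkCfg_zero (a b : SU2) : ∀ (n : ℕ) (y : Site 3 L), lineHolonomy (twoLinkCfg (L := L) a b) 0 n y = a ^ n
  | 0, y => by simp [lineHolonomy]
  | n + 1, y => by
    rw [lineHolonomy, lineHolonomy_twoLinkCfg_zero a b n, pow_succ']
    simp [twoLinkCfg]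

/-- Direction-1 line holonomies of the two-link configuration: `b^n`. [folklore] -/
theorem lineHolonomy_twoLinkCfg_one (a b : SU2) : ∀ (n : ℕ) (y : Site 3 L), lineHolonomy (twoLinkCfg (L := L) a b) 1 n y = b ^ n
  | 0, y => by simp [lineHolonomy]
  | n + 1, y => by
    rw [lineHolonomy, lineHolonomy_twoLinkCfg_one a b n, pow_succ']
    simp [twoLinkCfg]

/-- `scalarPart 1 = 1`. [folklore] -/
private theorem scalarPart_one' : scalarPart (1 : SU2) = 1 := by
  simp [scalarPart_eq]

/-- **Every plaquette term of the witness is `≤ 4 sin⁴φ`** (`= 4 sin⁴φ` in the `(0,1)` planes: `1 − u₀(a b a⁻¹ b⁻¹) = 2|u_a × u_b|² = 2 sin⁴φ`; `0` elsewhere).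
[cite: Luscher1983, §2] -/
theorem plaqTerm_twoLinkCfg_le {a b : SU2} {φ : ℝ} (ha : su2Quat a = ⟨Real.cos φ, Real.sin φ, 0, 0⟩)
    (hb : su2Quat b = ⟨Real.cos φ, 0, Real.sin φ, 0⟩) (p : Plaquette 3 L) :
    2 * (1 - scalarPart (plaquetteHolonomy (twoLinkCfg (L := L) a b) p.1 p.2.1.1 p.2.1.2)) ≤ 4 * Real.sin φ ^ 4 := by
  have h4 : 0 ≤ 4 * Real.sin φ ^ 4 := by positivity
  obtain ⟨-, ha0, ha1, ha2⟩ := entries_of_su2Quat_eq ha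
  obtain ⟨-, hb0, hb1, hb2⟩ := entries_of_su2Quat_eq hb
  obtain ⟨x, ⟨⟨i, j⟩, hij⟩⟩ := p
  dsimp only at hij ⊢
  fin_cases i <;> fin_cases j <;> first | exact absurd hij (by decide) | skip
  · -- the `(0,1)` plane: the commutator
    show 2 * (1 - scalarPart (plaquetteHolonomy (twoLinkCfg (L := L) a b) x 0 1)) ≤ 4 * Real.sin φ ^ 4
    rw [plaquetteHolonomy_twoLinkCfg, scalarPart_comm_eq, cross_apply]
    simp only [vecPart_zero, vecPart_one, vecPart_two, ha0, ha1, ha2, hb0, hb1, hb2]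
    simp [dotProduct, Fin.sum_univ_three]
    nlinarith [sq_nonneg (Real.sin φ)]
  · -- the `(0,2)` plane: trivial
    simp [plaquetteHolonomy, twoLinkCfg, scalarPart_one', h4]
  · -- the `(1,2)` plane: trivial
    simp [plaquetteHolonomy, twoLinkCfg, scalarPart_one', h4]

variable [NeZero L]

/-- **The action of the witness is quartic**: `S(twoLinkCfg a_φ b_φ) ≤ 4·#Plaquette·sin⁴φ`. [cite: Luscher1983, §2] -/
theorem wilsonAction_twoLinkCfg_le {a b : SU2} {φ : ℝ} (ha : su2Quat a = ⟨Real.cos φ, Real.sin φ, 0, 0⟩)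
    (hb : su2Quat b = ⟨Real.cos φ, 0, Real.sin φ, 0⟩) :
    wilsonAction su2Rep (twoLinkCfg (L := L) a b) ≤ 4 * (Fintype.card (Plaquette 3 L) : ℝ) * Real.sin φ ^ 4 := by
  rw [wilsonAction_eq_sum_scalarPart]
  calc ∑ p : Plaquette 3 L, 2 * (1 - scalarPart (hol (twoLinkCfg (L := L) a b) p))
      ≤ ∑ _p : Plaquette 3 L, 4 * Real.sin φ ^ 4 := Finset.sum_le_sum fun p _ => plaqTerm_twoLinkCfg_le ha hb p
    _ = 4 * (Fintype.card (Plaquette 3 L) : ℝ) * Real.sin φ ^ 4 := by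
      rw [Finset.sum_const, Finset.card_univ, nsmul_eq_mul]; ring

omit [NeZero L] in
/-- Moving the gauge transformation to the other side: `‖(g·U)_e − V_e‖_F = ‖U_e − (g⁻¹·V)_e‖_F`. [folklore] -/
theorem frobNorm_gaugeTransform_sub_swap (g : Site 3 L → SU2) (U V : GaugeConfig 3 L SU2) (e : Edge 3 L) :
    frobNorm (((gaugeTransform g U e : SU2) : Matrix (Fin 2) (Fin 2) ℂ) - (V e : Matrix (Fin 2) (Fin 2) ℂ)) =
      frobNorm ((U e : Matrix (Fin 2) (Fin 2) ℂ) - ((gaugeTransform (fun x => (g x)⁻¹) V e : SU2) : Matrix (Fin 2) (Fin 2) ℂ)) := by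
  simp only [gaugeTransform, inv_inv]
  have hid : (((g e.1 * U e * (g (e.1.shift e.2))⁻¹ : SU2)) : Matrix (Fin 2) (Fin 2) ℂ) - (V e : Matrix (Fin 2) (Fin 2) ℂ) =
      (g e.1 : Matrix (Fin 2) (Fin 2) ℂ) * ((U e : Matrix (Fin 2) (Fin 2) ℂ) - (((g e.1)⁻¹ * V e * g (e.1.shift e.2) : SU2) : Matrix (Fin 2) (Fin 2) ℂ)) *
        (((g (e.1.shift e.2))⁻¹ : SU2) : Matrix (Fin 2) (Fin 2) ℂ) := by
    rw [Matrix.mul_sub, Matrix.sub_mul, ← Submonoid.coe_mul, ← Submonoid.coe_mul, ← Submonoid.coe_mul, ← Submonoid.coe_mul,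
      show g e.1 * ((g e.1)⁻¹ * V e * g (e.1.shift e.2)) * (g (e.1.shift e.2))⁻¹ = V e by group]
  rw [hid, frobNorm_mul_unitary _ (su2_mem_unitaryGroup _), frobNorm_unitary_mul (su2_mem_unitaryGroup _)]

end Witness

/-! ## §5 ★ The refutation -/

/-- The real-arithmetic endgame: Jordan's `(2/π)Lφ ≤ sin(Lφ)`, the commuting-pair bound `sin²(Lφ) ≤ 2(Lδ)²`, the quartic action `δ² ≤ C²Kφ⁴` and the
smallness `(π²C²K + 1)φ ≤ 1` are incompatible. [folklore] -/
theorem flatProximity_endgame {Lr φ C K δ sn : ℝ} (hL : 0 < Lr) (hφ0 : 0 < φ) (hφ1 : φ ≤ 1) (hK : 0 ≤ K)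
    (hM : (Real.pi ^ 2 * C ^ 2 * K + 1) * φ ≤ 1) (hj : 2 / Real.pi * (Lr * φ) ≤ sn) (hkey : sn ^ 2 ≤ 2 * (Lr * δ) ^ 2)
    (hδ : δ ^ 2 ≤ C ^ 2 * (K * φ ^ 4)) : False := by
  have hπ : 0 < Real.pi := Real.pi_pos
  have ht : 0 < (Lr * φ) ^ 2 := by positivity
  have hA : (2 / Real.pi * (Lr * φ)) ^ 2 ≤ 2 * Lr ^ 2 * (C ^ 2 * (K * φ ^ 4)) :=
    calc (2 / Real.pi * (Lr * φ)) ^ 2 ≤ sn ^ 2 := pow_le_pow_left₀ (by positivity) hj 2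
      _ ≤ 2 * (Lr * δ) ^ 2 := hkey
      _ = 2 * Lr ^ 2 * δ ^ 2 := by ring
      _ ≤ 2 * Lr ^ 2 * (C ^ 2 * (K * φ ^ 4)) := mul_le_mul_of_nonneg_left hδ (by positivity)
  have hC : 4 / Real.pi ^ 2 ≤ 2 * C ^ 2 * K * φ ^ 2 := by
    refine le_of_mul_le_mul_right ?_ ht
    calc 4 / Real.pi ^ 2 * (Lr * φ) ^ 2 = (2 / Real.pi * (Lr * φ)) ^ 2 := by ring
      _ ≤ 2 * Lr ^ 2 * (C ^ 2 * (K * φ ^ 4)) := hA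
      _ = 2 * C ^ 2 * K * φ ^ 2 * (Lr * φ) ^ 2 := by ring
  have hD : 4 ≤ 2 * C ^ 2 * K * φ ^ 2 * Real.pi ^ 2 := (div_le_iff₀ (by positivity)).1 hC
  have hφsq : φ ^ 2 ≤ φ := by nlinarith
  have hE : Real.pi ^ 2 * C ^ 2 * K * φ ^ 2 ≤ Real.pi ^ 2 * C ^ 2 * K * φ := mul_le_mul_of_nonneg_left hφsq (by positivity)
  nlinarith [hD, hE, hM, hφ0]

/-- ★ **R8. The `√σ` flat-proximity brick (blueprint §6 c5 = C3c) is false at every fixed `L ≥ 1`.**  There are no constants `C`, `σ₀ > 0` such that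
every `SU(2)` lattice gauge field `U` on `(ℤ/L)³` with Wilson action `S(U) ≤ σ₀` is gauge-equivalent to a configuration all of whose links are within
Frobenius distance `C·√S(U)` of a FLAT configuration (`V` with all plaquette holonomies `= 1`).  Witness: the constant non-commuting two-link configurations
(`S ~ φ⁴`, distance to the flat connections `~ φ`).  The true modulus is `S^{1/4}` (quartic toron/constant modes). [cite: Luscher1983, §2] -/
theorem flatProximity_sqrt_false (L : ℕ) [NeZero L] :
    ¬ ∃ C σ₀ : ℝ, 0 < σ₀ ∧ ∀ U : GaugeConfig 3 L SU2, wilsonAction su2Rep U ≤ σ₀ →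
        ∃ (g : Site 3 L → SU2) (V : GaugeConfig 3 L SU2), (∀ x i j, plaquetteHolonomy V x i j = 1) ∧
          ∀ e, frobNorm (((gaugeTransform g U e : SU2) : Matrix (Fin 2) (Fin 2) ℂ) - (V e : Matrix (Fin 2) (Fin 2) ℂ)) ≤
            C * Real.sqrt (wilsonAction su2Rep U) := by
  rintro ⟨C, σ₀, hσ₀, H⟩
  -- constants of the lattice and a small angle
  set K : ℝ := 4 * (Fintype.card (Plaquette 3 L) : ℝ) with hK
  have hK0 : 0 ≤ K := by positivity
  have hLpos : (0 : ℝ) < L := Nat.cast_pos.2 (Nat.pos_of_ne_zero (NeZero.ne L))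
  have hπ := Real.pi_pos
  set φ : ℝ := min (min 1 (Real.pi / 2 / L)) (min (σ₀ / (K + 1)) (1 / (Real.pi ^ 2 * C ^ 2 * K + 1))) with hφ
  have hφ0 : 0 < φ := lt_min (lt_min one_pos (div_pos (by positivity) hLpos)) (lt_min (by positivity) (by positivity))
  have hφ1 : φ ≤ 1 := (min_le_left _ _).trans (min_le_left _ _)
  have hφL : (L : ℝ) * φ ≤ Real.pi / 2 := by
    have h : φ ≤ Real.pi / 2 / L := (min_le_left _ _).trans (min_le_right _ _)
    rw [le_div_iff₀ hLpos] at h; linarith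
  have hφσ : (K + 1) * φ ≤ σ₀ := by
    have h : φ ≤ σ₀ / (K + 1) := (min_le_right _ _).trans (min_le_left _ _)
    rw [le_div_iff₀ (by positivity)] at h; linarith
  have hφM : (Real.pi ^ 2 * C ^ 2 * K + 1) * φ ≤ 1 := by
    have h : φ ≤ 1 / (Real.pi ^ 2 * C ^ 2 * K + 1) := (min_le_right _ _).trans (min_le_right _ _)
    rw [le_div_iff₀ (by positivity)] at h; linarith
  -- the witness
  obtain ⟨a, ha⟩ := exists_su2Quat_eq _ (normSq_axisI φ)
  obtain ⟨b, hb⟩ := exists_su2Quat_eq _ (normSq_axisJ φ)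
  have hsin0 : 0 ≤ Real.sin φ := Real.sin_nonneg_of_nonneg_of_le_pi hφ0.le (by linarith [Real.pi_gt_three])
  have hsin1 : Real.sin φ ≤ φ := Real.sin_le hφ0.le
  have hsin4 : Real.sin φ ^ 4 ≤ φ ^ 4 := pow_le_pow_left₀ hsin0 hsin1 4
  have hφ4 : φ ^ 4 ≤ φ := pow_le_of_le_one hφ0.le hφ1 (by norm_num)
  have hS0 : 0 ≤ wilsonAction su2Rep (twoLinkCfg (L := L) a b) := wilsonAction_su2_nonneg_lat _
  have hSφ : wilsonAction su2Rep (twoLinkCfg (L := L) a b) ≤ K * φ ^ 4 :=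
    (wilsonAction_twoLinkCfg_le ha hb).trans (mul_le_mul_of_nonneg_left hsin4 hK0)
  have hSσ : wilsonAction su2Rep (twoLinkCfg (L := L) a b) ≤ σ₀ := by
    have : K * φ ^ 4 ≤ K * φ := mul_le_mul_of_nonneg_left hφ4 hK0
    linarith
  obtain ⟨g, V, hV, hclose⟩ := H _ hSσ
  -- move the gauge transformation onto the flat side
  have hV' : ∀ x i j, plaquetteHolonomy (gaugeTransform (fun x => (g x)⁻¹) V) x i j = 1 :=
    plaquetteHolonomy_gaugeTransform_eq_one hV _
  have hclose' : ∀ e, frobNorm (((twoLinkCfg (L := L) a b e : SU2) : Matrix (Fin 2) (Fin 2) ℂ) -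
      ((gaugeTransform (fun x => (g x)⁻¹) V e : SU2) : Matrix (Fin 2) (Fin 2) ℂ)) ≤
        C * Real.sqrt (wilsonAction su2Rep (twoLinkCfg (L := L) a b)) := fun e => by
    rw [← frobNorm_gaugeTransform_sub_swap]; exact hclose e
  -- the two full-period line holonomies at the origin
  have hd0 := frobNorm_lineHolonomy_sub_le hclose' 0 L 0
  have hd1 := frobNorm_lineHolonomy_sub_le hclose' 1 L 0
  rw [lineHolonomy_twoLinkCfg_zero] at hd0
  rw [lineHolonomy_twoLinkCfg_one] at hd1
  have hcommV := lineHolonomy_comm_of_flat hV' 0 1 (0 : Site 3 L)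
  have hsL : 0 < Real.sin (L * φ) := Real.sin_pos_of_pos_of_lt_pi (by positivity) (by linarith)
  -- the linear lower bound against the quadratic upper bound
  have hkey := sq_le_of_commute_near_axes hcommV hsL (su2Quat_pow_axisI ha L) (su2Quat_pow_axisJ hb L) hd0 hd1
  have hjordan : 2 / Real.pi * (L * φ) ≤ Real.sin (L * φ) := Real.mul_le_sin (by positivity) hφL
  have hδsq : (C * Real.sqrt (wilsonAction su2Rep (twoLinkCfg (L := L) a b))) ^ 2 ≤ C ^ 2 * (K * φ ^ 4) := by
    rw [mul_pow, Real.sq_sqrt hS0]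
    exact mul_le_mul_of_nonneg_left hSφ (sq_nonneg C)
  exact flatProximity_endgame hLpos hφ0 hφ1 hK0 hφM hjordan hkey hδsq

/-- ★ The same without the gauge freedom (`g ≡ 1`): no `C`, `σ₀ > 0` with `S(U) ≤ σ₀ ⇒ ∃ V flat, ∀ e, ‖U_e − V_e‖_F ≤ C √S(U)`. [cite: Luscher1983, §2] -/
theorem flatProximity_sqrt_false' (L : ℕ) [NeZero L] :
    ¬ ∃ C σ₀ : ℝ, 0 < σ₀ ∧ ∀ U : GaugeConfig 3 L SU2, wilsonAction su2Rep U ≤ σ₀ →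
        ∃ V : GaugeConfig 3 L SU2, (∀ x i j, plaquetteHolonomy V x i j = 1) ∧
          ∀ e, frobNorm ((U e : Matrix (Fin 2) (Fin 2) ℂ) - (V e : Matrix (Fin 2) (Fin 2) ℂ)) ≤ C * Real.sqrt (wilsonAction su2Rep U) := by
  rintro ⟨C, σ₀, hσ₀, H⟩
  refine flatProximity_sqrt_false L ⟨C, σ₀, hσ₀, fun U hU => ?_⟩
  obtain ⟨V, hV, hclose⟩ := H U hU
  exact ⟨fun _ => 1, V, hV, fun e => by rw [gaugeTransform_one]; exact hclose e⟩

end Summit.QuantumFields.YangMills.Theorems.TwistedTraceScaling.Negative.R8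

end
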